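import Summits.QuantumFields.QCD.Theorems.QuarksAsStableActionCriticalLineDiamagnetismCellNorms

/-!
# Stub `heavyInvertible` of line `Sketch` (crux `stmt-QuantumFields-9734`, Route B of the heavy-frequency gain)

Sub-problem context: `Summits/QuantumFields/QCD/Statement.lean`; crux decl
`Summit.QuantumFields.QCD.Theses.QuarksAsStableAction.CriticalLineDiamagnetism`; registered Route-B helper stub
`heavyInvertible`.

At a heavy frequency (`|m| ≤ 1/10`, `cos ω₀, cos ω₁ ≤ −199/200`) the rectangular 2D frequency operator
`freqOpR γ A m ω₀ ω₁` (file `…RectFreqOpDefs`) of EVERY field `A` on every two-torus `ℤ/L₁ × ℤ/L₂` has a unit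
determinant.  Proof (Neumann series in lower-bound form): by `cellNorms` (file `…CellNorms`),
`(M_ω − 2)·‖v‖ ≤ ‖freqOpR γ A m ω₀ ω₁ v‖` in `ℓ²`, with `M_ω − 2 = m + 2 − cos ω₀ − cos ω₁ ≥ 389/100 > 0`; hence
`v ↦ freqOpR v` is injective, so `freqOpR` is a unit (`Matrix.mulVec_injective_iff_isUnit`) and so is its determinant.
-/

noncomputable section

open scoped BigOperators Matrix
open Matrix Literature.MathematicalPhysics.QuantumLattice
open Summit.QuantumFields.QCD.Cruxes.CriticalLineDiamagnetism.ChessboardCellGain.FrequencyDiamagnetism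

namespace Summit.QuantumFields.QCD.Cruxes.CriticalLineDiamagnetism.ChessboardCellGain

/-- **Stub `heavyInvertible`**: at a heavy frequency (`|m| ≤ 1/10`, `cos ω_i ≤ −199/200`) the rectangular 2D frequency
operator of EVERY field is invertible: `IsUnit (freqOpR γ A m ω₀ ω₁).det`.  Neumann series in lower-bound form:
`(M_ω − 2)‖v‖ ≤ ‖freqOpR v‖` (`cellNorms`) with `M_ω − 2 ≥ 389/100`, so `freqOpR` is injective, hence a unit. -/
theorem heavyInvertible : ∀ (L₁ L₂ : ℕ) [NeZero L₁] [NeZero L₂] (A : ZMod L₁ → ZMod L₂ → Fin 4 → Matrix.unitaryGroup (Fin 3) ℂ) (m : ℝ), |m| ≤ 1 / 10 → ∀ ω₀ ω₁ : ℝ, Real.cos ω₀ ≤ -(199 / 200) → Real.cos ω₁ ≤ -(199 / 200) → IsUnit (freqOpR euclideanGamma A m ω₀ ω₁).det := by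
  intro L₁ L₂ _ _ A m hm ω₀ ω₁ hω₀ hω₁
  have hM : (389 / 100 : ℝ) ≤ m + 4 - Real.cos ω₀ - Real.cos ω₁ - 2 := by
    have := (abs_le.mp hm).1
    linarith
  have hγ : ∀ μ : Fin 4, (euclideanGamma μ)ᴴ = euclideanGamma μ := fun μ => (euclideanGamma_isHermitian μ).eq
  -- the `ℓ²` lower bound
  have hlow : ∀ v : (ZMod L₁ × ZMod L₂) × Fin 3 × Fin 4 → ℂ,
      (m + 4 - Real.cos ω₀ - Real.cos ω₁ - 2) *
        ‖(WithLp.toLp 2 v : EuclideanSpace ℂ ((ZMod L₁ × ZMod L₂) × Fin 3 × Fin 4))‖ ≤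
      ‖(WithLp.toLp 2 (freqOpR euclideanGamma A m ω₀ ω₁ *ᵥ v) :
        EuclideanSpace ℂ ((ZMod L₁ × ZMod L₂) × Fin 3 × Fin 4))‖ :=
    fun v => cellNorms L₁ L₂ euclideanGamma hγ euclideanGamma_mul_self A m ω₀ ω₁ v
  -- injectivity, hence invertibility
  have hinj : Function.Injective (freqOpR euclideanGamma A m ω₀ ω₁).mulVec := by
    intro v w hvw
    have h := hlow (v - w)
    rw [Matrix.mulVec_sub, hvw, sub_self, WithLp.toLp_zero, norm_zero] at h
    have h0 : ‖(WithLp.toLp 2 (v - w) : EuclideanSpace ℂ ((ZMod L₁ × ZMod L₂) × Fin 3 × Fin 4))‖ ≤ 0 :=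
      le_of_mul_le_mul_left (by rw [mul_zero]; exact h) (by linarith)
    have h1 := norm_le_zero_iff.mp h0
    rwa [WithLp.toLp_eq_zero, sub_eq_zero] at h1
  exact (Matrix.isUnit_iff_isUnit_det _).mp (Matrix.mulVec_injective_iff_isUnit.mp hinj)

end Summit.QuantumFields.QCD.Cruxes.CriticalLineDiamagnetism.ChessboardCellGain

end
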